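import Literature.NumberTheory.BeurlingPrimes.PerronShift
import Literature.NumberTheory.LFunctions.RieszKernelTwo
import Mathlib.Analysis.SpecialFunctions.JapaneseBracket
import Mathlib.Analysis.SpecialFunctions.ImproperIntegrals
import HarnessLib

/-!
# Effective Perron inversion of order two: a power-saving count from a continuation of finite order

Topic `Literature/NumberTheory/LFunctions` (next to `RieszMeanPerron`). Everything in this file is PROVED; no
named fact is introduced.

**Setting.** `λ : ι → ℝ` a countable family with `λ_i ≥ 1`, weights `a_i ≥ 0`, and generalized Dirichlet series
`D(s) = Σ_i a_i λ_i^{-s}` absolutely convergent for `Re s > δ > 0`; counting function `N(x) = Σ_i a_i 𝟙{λ_i ≤ x}`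
(`= #{i : λ_i ≤ x}` for `a ≡ 1`; weights are needed for the renewal functions `Σ_w G(γ_w x) 𝟙{·}` of
transfer-operator counting, where `D(s) = Σ_n (L_s^n G)(x)` is a resolvent).
**Hypothesis.** `D(s) = r/(s − δ) + H(s)` on `Re s > δ` with `r ≥ 0`, `H` holomorphic on `Re s > σ₀` and of finite
order in the strip: `‖H(u + it)‖ ≤ M (1 + |t|)^κ` for `σ₁ ≤ u ≤ δ + 1`, `0 ≤ σ₀ < σ₁ < δ`, with `κ < 2`.
**Conclusion.** `|N(x) − r x^δ/δ| ≤ C · x^{δ − (δ − σ₁)/3}` for `x ≥ 2`, with `C` explicit and linear in `M` and `r`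
(`PerronTwo.abs_countFn_sub_main_le`, `PerronTwo.abs_ncard_sub_main_le`).

This is the classical "spectral bound ⇒ power saving" engine of counting problems (e.g. [MageeOhWinter2019, §3.4,
Lemma 15 – Prop. 17], there with a smooth compactly supported kernel; [Lalley1989]; Bourgain–Gamburd–Sarnak 2011),
here run with the **Riesz mean of order two** `N₂(y) = Σ_i a_i (y − λ_i)₊²/2`, whose Perron integral
`N₂(y) = (1/2πi) ∫_{(σ)} y^{s+2} D(s) ds/(s(s+1)(s+2))` converges absolutely as soon as `D` has order `< 2` on the
line (kernel `≍ |t|^{-3}`), followed by a shift of the line of integration to `Re s = σ₁` (the pole at `δ` is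
removed beforehand by subtracting the Perron integral of the continuous majorant `r u^{δ-1} du`, so only the
pole-free line shift `DMV.integral_line_eq_of_tendsto` of the tree is needed) and by **second-difference
unsmoothing** `h² N(x) ≤ Δ_h² N₂(x) ≤ h² N(x + 2h)` (monotonicity of `N`), `h = x^{1-θ}/4`, `θ = (δ − σ₁)/3`.
The order-one version of the Perron step is the tree's `RieszMeanPerron` / `BeurlingPerronFormula` / `PerronShift`
(order one needs order `κ < 1`; transfer-operator resolvent bounds in Lipschitz norms naturally give `κ = 1`, whence
order two here); the elementary bound `(σ+|t|)/2 ≤ ‖σ+it‖` is reused from `PerronShift` (`half_add_abs_le_norm`), and the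
kernel facts (non-vanishing, integrability, Mellin pair, kernel evaluation) are derived from the Cesàro-normalised order-two kernel
`2/(s(s+1)(s+2))` of `RieszKernelTwo` (`kernel₂Den_ne_zero`, `integrable_rieszKernel₂`, `hasMellin_oneSubSq_indicator`,
`mellinInv_rieszKernel₂_eq`) by the factor `½`.

## References
* [MageeOhWinter2019] M. Magee, H. Oh, D. Winter, J. reine angew. Math. 753 (2019), §3.4 (Lemma 15, Lemma 16,
  Prop. 17: smoothing, Laplace inversion, contour shift to `Re s = δ − ε'`, unsmoothing by monotonicity).
* A. E. Ingham, *The Distribution of Prime Numbers*, Ch. II §5 Theorem B (Riesz means of order `k`,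
  kernel `k!/(s(s+1)⋯(s+k))`).
* H. L. Montgomery, R. C. Vaughan, *Multiplicative Number Theory I*, §5.1 (Riesz means).
-/

noncomputable section

open Complex Filter Set MeasureTheory Real
open scoped Topology Interval

namespace Literature.NumberTheory.LFunctions

namespace PerronTwo

open Literature.NumberTheory.BeurlingPrimes (half_add_abs_le_norm)

/-! ### The kernel `1/(s(s+1)(s+2))` on vertical lines -/

/-- The order-two Perron kernel `k₂(s) = 1/(s(s+1)(s+2))` (Mellin transform of `(1 − x)₊²/2` on `(0, 1]`).
[folklore] -/
def kernel2 (s : ℂ) : ℂ := 1 / (s * (s + 1) * (s + 2))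

/-- `‖(σ+it)(σ+1+it)(σ+2+it)‖ ≥ (σ + |t|)(1 + |t|)²/8` for `σ ≥ 0`. [folklore] -/
theorem norm_den_ge {σ : ℝ} (hσ : 0 ≤ σ) (t : ℝ) :
    (σ + |t|) * (1 + |t|) ^ 2 / 8 ≤
      ‖((σ : ℂ) + t * I) * ((σ : ℂ) + t * I + 1) * ((σ : ℂ) + t * I + 2)‖ := by
  rw [norm_mul, norm_mul]
  have h0 := half_add_abs_le_norm hσ t
  have h1 : (1 + |t|) / 2 ≤ ‖(σ : ℂ) + t * I + 1‖ := by
    have h := half_add_abs_le_norm (σ := σ + 1) (by linarith) t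
    have heq : ((σ + 1 : ℝ) : ℂ) + t * I = (σ : ℂ) + t * I + 1 := by push_cast; ring
    rw [heq] at h; linarith
  have h2 : (1 + |t|) / 2 ≤ ‖(σ : ℂ) + t * I + 2‖ := by
    have h := half_add_abs_le_norm (σ := σ + 2) (by linarith) t
    have heq : ((σ + 2 : ℝ) : ℂ) + t * I = (σ : ℂ) + t * I + 2 := by push_cast; ring
    rw [heq] at h; linarith
  have ht := abs_nonneg t
  calc (σ + |t|) * (1 + |t|) ^ 2 / 8 = ((σ + |t|) / 2) * ((1 + |t|) / 2) * ((1 + |t|) / 2) := by ring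
    _ ≤ ‖(σ : ℂ) + t * I‖ * ‖(σ : ℂ) + t * I + 1‖ * ‖(σ : ℂ) + t * I + 2‖ := by
      apply mul_le_mul (mul_le_mul h0 h1 (by positivity) (norm_nonneg _)) h2 (by positivity)
      positivity

/-- `‖k₂(σ + it)‖ ≤ 8/((σ + |t|)(1 + |t|)²)` for `σ > 0`. [folklore] -/
theorem norm_kernel2_le {σ : ℝ} (hσ : 0 < σ) (t : ℝ) :
    ‖kernel2 ((σ : ℂ) + t * I)‖ ≤ 8 / ((σ + |t|) * (1 + |t|) ^ 2) := by
  unfold kernel2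
  rw [norm_div, norm_one, div_le_div_iff₀ (norm_pos_iff.2 (kernel₂Den_ne_zero hσ t)) (by positivity), one_mul]
  have := norm_den_ge hσ.le t
  linarith

/-- `‖k₂(σ + it)‖ ≤ (8/min(σ,1)) (1 + |t|)^{-3}` for `σ > 0`. [folklore] -/
theorem norm_kernel2_le' {σ : ℝ} (hσ : 0 < σ) (t : ℝ) :
    ‖kernel2 ((σ : ℂ) + t * I)‖ ≤ 8 / min σ 1 * (1 + |t|) ^ (-(3 : ℝ)) := by
  have hm : 0 < min σ 1 := lt_min hσ one_pos
  have ht : 0 ≤ |t| := abs_nonneg t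
  have hkey : min σ 1 * (1 + |t|) ≤ σ + |t| := by
    have := min_le_left σ 1; have := min_le_right σ 1
    nlinarith
  refine (norm_kernel2_le hσ t).trans ?_
  rw [rpow_neg (by positivity), show (3 : ℝ) = ((3 : ℕ) : ℝ) by norm_num, rpow_natCast, ← div_eq_mul_inv,
    div_le_div_iff₀ (by positivity) (by positivity)]
  calc 8 * (1 + |t|) ^ 3 = 8 * ((1 + |t|) * (1 + |t|) ^ 2) := by ring
    _ ≤ 8 * ((σ + |t|) / min σ 1 * (1 + |t|) ^ 2) := by
        gcongr
        rw [le_div_iff₀ hm]; linarith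
    _ = 8 / min σ 1 * ((σ + |t|) * (1 + |t|) ^ 2) := by ring

/-- `k₂` is differentiable away from `0, -1, -2`, in particular on `Re s > 0`. [folklore] -/
theorem differentiableAt_kernel2 {s : ℂ} (hs : 0 < s.re) : DifferentiableAt ℂ kernel2 s := by
  unfold kernel2
  have h0 : s ≠ 0 := by rintro rfl; simp at hs
  have h1 : s + 1 ≠ 0 := fun h => by have := congrArg Complex.re h; simp at this; linarith
  have h2 : s + 2 ≠ 0 := fun h => by have := congrArg Complex.re h; simp at this; linarith
  refine (differentiableAt_const _).div (by fun_prop) ?_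
  exact mul_ne_zero (mul_ne_zero h0 h1) h2

/-- `t ↦ k₂(σ + it)` is continuous for `σ > 0`. [folklore] -/
theorem continuous_kernel2_vertical {σ : ℝ} (hσ : 0 < σ) : Continuous fun t : ℝ => kernel2 ((σ : ℂ) + t * I) := by
  unfold kernel2
  exact Continuous.div continuous_const (by fun_prop) (kernel₂Den_ne_zero hσ)

/-- `t ↦ (1 + |t|)^{-a}` is integrable on `ℝ` for `a > 1`. [folklore] -/
theorem integrable_one_add_abs_rpow_neg {a : ℝ} (ha : 1 < a) : Integrable fun t : ℝ => (1 + |t|) ^ (-a) := by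
  have h := integrable_one_add_norm (E := ℝ) (μ := volume) (r := a) (by simpa using ha)
  simpa only [Real.norm_eq_abs] using h

/-- **Weighted integrability of the kernel:** `t ↦ (1 + |t|)^κ ‖k₂(σ + it)‖` is integrable for `κ < 2`, with
`∫ (1+|t|)^κ ‖k₂(σ+it)‖ dt ≤ (8/min(σ,1)) ∫ (1+|t|)^{κ-3} dt`. [folklore] -/
theorem integrable_weight_mul_norm_kernel2 {σ : ℝ} (hσ : 0 < σ) {κ : ℝ} (hκ : κ < 2) :
    Integrable (fun t : ℝ => (1 + |t|) ^ κ * ‖kernel2 ((σ : ℂ) + t * I)‖) ∧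
      ∫ t : ℝ, (1 + |t|) ^ κ * ‖kernel2 ((σ : ℂ) + t * I)‖ ≤
        8 / min σ 1 * ∫ t : ℝ, (1 + |t|) ^ (-(3 - κ)) := by
  have hm : 0 < min σ 1 := lt_min hσ one_pos
  have hmaj : Integrable fun t : ℝ => 8 / min σ 1 * (1 + |t|) ^ (-(3 - κ)) :=
    (integrable_one_add_abs_rpow_neg (by linarith)).const_mul _
  have hpt : ∀ t : ℝ, (1 + |t|) ^ κ * ‖kernel2 ((σ : ℂ) + t * I)‖ ≤ 8 / min σ 1 * (1 + |t|) ^ (-(3 - κ)) := by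
    intro t
    have h1 : (0 : ℝ) < 1 + |t| := by positivity
    calc (1 + |t|) ^ κ * ‖kernel2 ((σ : ℂ) + t * I)‖
        ≤ (1 + |t|) ^ κ * (8 / min σ 1 * (1 + |t|) ^ (-(3 : ℝ))) :=
          mul_le_mul_of_nonneg_left (norm_kernel2_le' hσ t) (by positivity)
      _ = 8 / min σ 1 * (1 + |t|) ^ (-(3 - κ)) := by
          rw [show -(3 - κ) = κ + -(3 : ℝ) by ring, rpow_add h1]; ring
  have hmeas : AEStronglyMeasurable (fun t : ℝ => (1 + |t|) ^ κ * ‖kernel2 ((σ : ℂ) + t * I)‖) volume := by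
    refine Continuous.aestronglyMeasurable (Continuous.mul ?_ (continuous_kernel2_vertical hσ).norm)
    exact Continuous.rpow_const (by fun_prop) fun t => Or.inl (by positivity)
  have hint : Integrable (fun t : ℝ => (1 + |t|) ^ κ * ‖kernel2 ((σ : ℂ) + t * I)‖) := by
    refine hmaj.mono' hmeas (Eventually.of_forall fun t => ?_)
    rw [Real.norm_eq_abs, abs_of_nonneg (by positivity)]
    exact hpt t
  refine ⟨hint, ?_⟩
  rw [← integral_const_mul]
  exact integral_mono hint hmaj hpt

/-- `k₂ = ½ · (2/(s(s+1)(s+2)))`: the kernel is half the Cesàro-normalised kernel of `RieszKernelTwo`. [folklore] -/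
theorem kernel2_eq_half (s : ℂ) : kernel2 s = (1 / 2 : ℂ) * (2 / (s * (s + 1) * (s + 2))) := by
  unfold kernel2; ring

/-- In particular `t ↦ k₂(σ + it)` is integrable for `σ > 0` (from `integrable_rieszKernel₂`). [folklore] -/
theorem integrable_kernel2 {σ : ℝ} (hσ : 0 < σ) : Integrable fun t : ℝ => kernel2 ((σ : ℂ) + t * I) := by
  have h := (integrable_rieszKernel₂ hσ).const_mul (1 / 2 : ℂ)
  exact h.congr (Eventually.of_forall fun t => (kernel2_eq_half _).symm)

/-! ### The Mellin pair `(1 − x)₊²/2 ↔ k₂` and the kernel identity -/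

/-- The Mellin transform of `x ↦ (1 − x)²/2 · 𝟙_{(0,1]}(x)` is `k₂(s) = 1/(s(s+1)(s+2))` for `Re s > 0`
(half of the pair `hasMellin_oneSubSq_indicator` of `RieszKernelTwo`). [cite: MontgomeryVaughan2007, §5.1 (5.17)–(5.19)] -/
theorem hasMellin_oneSub_sq_indicator {s : ℂ} (hs : 0 < s.re) :
    HasMellin ((Ioc 0 1).indicator fun y : ℝ => ((1 : ℂ) - y) ^ 2 / 2) s (kernel2 s) := by
  have h := hasMellin_const_smul (hasMellin_oneSubSq_indicator hs).1 (c := (1 / 2 : ℂ))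
  rw [(hasMellin_oneSubSq_indicator hs).2] at h
  have heq : (fun y : ℝ => (1 / 2 : ℂ) • (Ioc 0 1).indicator (fun y : ℝ => ((1 : ℂ) - y) ^ 2) y) =
      (Ioc 0 1).indicator fun y : ℝ => ((1 : ℂ) - y) ^ 2 / 2 := by
    funext y
    by_cases hy : y ∈ Ioc (0 : ℝ) 1
    · simp only [Set.indicator_of_mem hy, smul_eq_mul]; ring
    · simp [Set.indicator_of_notMem hy]
  rw [heq] at h
  refine ⟨h.1, ?_⟩
  rw [h.2, kernel2_eq_half, smul_eq_mul]

/-- **The Perron kernel of order two:** for `σ > 0` and `y > 0`,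
`(1/2πi) ∫_{(σ)} y^{−s} ds/(s(s+1)(s+2)) = (1 − y)₊²/2` (half of `mellinInv_rieszKernel₂_eq` of `RieszKernelTwo`).
[cite: MontgomeryVaughan2007, §5.1 (5.17)–(5.19)] -/
theorem mellinInv_kernel2_eq {σ : ℝ} (hσ : 0 < σ) {y : ℝ} (hy : 0 < y) :
    mellinInv σ kernel2 y = (((max (1 - y) 0) ^ 2 / 2 : ℝ) : ℂ) := by
  have h := mellinInv_rieszKernel₂_eq hσ hy
  unfold mellinInv at h ⊢
  have hpt : ∀ t : ℝ, (y : ℂ) ^ (-((σ : ℂ) + t * I)) • kernel2 ((σ : ℂ) + t * I) =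
      (1 / 2 : ℂ) * ((y : ℂ) ^ (-((σ : ℂ) + t * I)) •
        (fun s : ℂ => 2 / (s * (s + 1) * (s + 2))) ((σ : ℂ) + t * I)) := by
    intro t; simp only [smul_eq_mul, kernel2_eq_half]; ring
  rw [integral_congr_ae (Eventually.of_forall hpt), integral_const_mul, ← mul_smul_comm, h]
  push_cast
  ring

/-! ### One term of the Perron integral -/

/-- **One term:** for `y, n > 0`, `σ > 0`, `s = σ + it`:
`(y − n)₊²/2 = (1/2π) ∫ y^{2+s} n^{−s} k₂(s) dt` (the kernel identity at `v = n/y`, times `y²`). [folklore] -/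
theorem sq_posPart_eq_integral {y n : ℝ} (hy : 0 < y) (hn : 0 < n) {σ : ℝ} (hσ : 0 < σ) :
    (((max (y - n) 0) ^ 2 / 2 : ℝ) : ℂ) =
      (1 / (2 * π) : ℂ) * ∫ t : ℝ, (y : ℂ) ^ (2 + ((σ : ℂ) + t * I)) * (n : ℂ) ^ (-((σ : ℂ) + t * I)) *
        kernel2 ((σ : ℂ) + t * I) := by
  have hy' : 0 < n / y := div_pos hn hy
  have hK := mellinInv_kernel2_eq hσ hy'
  unfold mellinInv at hK
  -- `y² · (1 − n/y)₊²/2 = (y − n)₊²/2`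
  have hmax : y * max (1 - n / y) 0 = max (y - n) 0 := by
    rw [mul_max_of_nonneg _ _ hy.le, mul_sub, mul_one, mul_div_cancel₀ _ hy.ne', mul_zero]
  have hlhs : (((max (y - n) 0) ^ 2 / 2 : ℝ) : ℂ) = (y : ℂ) ^ 2 * (((max (1 - n / y) 0) ^ 2 / 2 : ℝ) : ℂ) := by
    rw [← hmax]; push_cast; ring
  rw [hlhs, ← hK, Complex.real_smul]
  have hy0 : (y : ℂ) ≠ 0 := ofReal_ne_zero.2 hy.ne'
  have hnC : (n : ℂ) ≠ 0 := ofReal_ne_zero.2 hn.ne'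
  have hpt : ∀ t : ℝ, (y : ℂ) ^ 2 *
      (((n : ℂ) / (y : ℂ)) ^ (-((σ : ℂ) + t * I)) • kernel2 ((σ : ℂ) + t * I)) =
      (y : ℂ) ^ (2 + ((σ : ℂ) + t * I)) * (n : ℂ) ^ (-((σ : ℂ) + t * I)) * kernel2 ((σ : ℂ) + t * I) := by
    intro t
    set s : ℂ := (σ : ℂ) + t * I with hs
    simp only [smul_eq_mul]
    have hpow : ((n : ℂ) / (y : ℂ)) ^ (-s) = (y : ℂ) ^ s / (n : ℂ) ^ s := by
      rw [show (n : ℂ) / (y : ℂ) = (((n * y⁻¹ : ℝ)) : ℂ) by push_cast; ring, cpow_neg,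
        ofReal_mul, mul_cpow_ofReal_nonneg hn.le (inv_nonneg.2 hy.le), ofReal_inv,
        inv_cpow _ _ ?_, mul_inv, inv_inv]
      · ring
      · rw [arg_ofReal_of_nonneg hy.le]; exact Real.pi_pos.ne
    have hns : (n : ℂ) ^ s ≠ 0 := cpow_ne_zero_iff.2 (Or.inl hnC)
    rw [hpow, cpow_neg]
    conv_rhs => rw [cpow_add _ _ hy0, cpow_ofNat]
    field_simp
  calc (y : ℂ) ^ 2 * ((((1 / (2 * π) : ℝ)) : ℂ) *
        ∫ t : ℝ, (((n / y : ℝ)) : ℂ) ^ (-((σ : ℂ) + t * I)) • kernel2 ((σ : ℂ) + t * I))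
      = (((1 / (2 * π) : ℝ)) : ℂ) * ∫ t : ℝ, (y : ℂ) ^ 2 *
          ((((n / y : ℝ)) : ℂ) ^ (-((σ : ℂ) + t * I)) • kernel2 ((σ : ℂ) + t * I)) := by
        rw [integral_const_mul]; ring
    _ = _ := by
        push_cast
        congr 1
        exact integral_congr_ae (Eventually.of_forall hpt)

/-! ### The weighted Riesz mean of order two of a countable family and its Perron integral -/

section Family

variable {ι : Type*} (a ℓ : ι → ℝ)

/-- The weighted counting function `N(x) = Σ_i a_i 𝟙{ℓ_i ≤ x}` (for `a ≡ 1`, the number `#{i : ℓ_i ≤ x}`,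
`countFn_one_eq_ncard`). [folklore] -/
def countFn (x : ℝ) : ℝ := ∑' i, a i * (if ℓ i ≤ x then (1 : ℝ) else 0)

/-- The weighted Riesz mean of order two `N₂(y) = Σ_i a_i (y − ℓ_i)₊²/2 = ∫₀^y ∫₀^v N(u) du dv`. [folklore] -/
def riesz2 (y : ℝ) : ℝ := ∑' i, a i * ((max (y - ℓ i) 0) ^ 2 / 2)

/-- The weighted generalized Dirichlet series `D(s) = Σ_i a_i ℓ_i^{−s}`. [folklore] -/
def dirSeries (s : ℂ) : ℂ := ∑' i, (a i : ℂ) * ((ℓ i : ℝ) : ℂ) ^ (-s)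

variable {a ℓ}
variable (ha : ∀ i, 0 ≤ a i) (hℓ : ∀ i, 1 ≤ ℓ i)

include hℓ in
/-- `‖ℓ_i^{−s}‖ = ℓ_i^{−Re s}`. [folklore] -/
theorem norm_cpow_neg (i : ι) (s : ℂ) : ‖((ℓ i : ℝ) : ℂ) ^ (-s)‖ = ℓ i ^ (-s.re) := by
  rw [norm_cpow_eq_rpow_re_of_pos (by linarith [hℓ i])]; simp

include ha hℓ in
/-- `‖a_i ℓ_i^{−s}‖ = a_i ℓ_i^{−Re s}`. [folklore] -/
theorem norm_term (i : ι) (s : ℂ) : ‖(a i : ℂ) * ((ℓ i : ℝ) : ℂ) ^ (-s)‖ = a i * ℓ i ^ (-s.re) := by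
  rw [norm_mul, norm_cpow_neg hℓ, Complex.norm_real, Real.norm_eq_abs, abs_of_nonneg (ha i)]

include ha hℓ in
/-- The weighted indicator is dominated: `a_i 𝟙{ℓ_i ≤ x} ≤ x^σ a_i ℓ_i^{−σ}` for `σ ≥ 0`, `x > 0`. [folklore] -/
theorem indicator_le {σ : ℝ} (hσ : 0 ≤ σ) {x : ℝ} (hx : 0 < x) (i : ι) :
    a i * (if ℓ i ≤ x then (1 : ℝ) else 0) ≤ x ^ σ * (a i * ℓ i ^ (-σ)) := by
  have hi : 0 < ℓ i := by linarith [hℓ i]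
  have key : (if ℓ i ≤ x then (1 : ℝ) else 0) ≤ x ^ σ * ℓ i ^ (-σ) := by
    split_ifs with h
    · rw [rpow_neg hi.le, ← div_eq_mul_inv, le_div_iff₀ (rpow_pos_of_pos hi σ), one_mul]
      exact rpow_le_rpow hi.le h hσ
    · positivity
  calc a i * (if ℓ i ≤ x then (1 : ℝ) else 0) ≤ a i * (x ^ σ * ℓ i ^ (-σ)) :=
        mul_le_mul_of_nonneg_left key (ha i)
    _ = x ^ σ * (a i * ℓ i ^ (-σ)) := by ring

include ha hℓ in
/-- `a_i (y − ℓ_i)₊²/2 ≤ (y^{2+σ}/2) a_i ℓ_i^{−σ}` for `σ ≥ 0`, `y > 0`. [folklore] -/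
theorem sq_posPart_le {σ : ℝ} (hσ : 0 ≤ σ) {y : ℝ} (hy : 0 < y) (i : ι) :
    a i * ((max (y - ℓ i) 0) ^ 2 / 2) ≤ y ^ (2 + σ) / 2 * (a i * ℓ i ^ (-σ)) := by
  have hi : 0 < ℓ i := by linarith [hℓ i]
  have key : (max (y - ℓ i) 0) ^ 2 / 2 ≤ y ^ (2 + σ) / 2 * ℓ i ^ (-σ) := by
    by_cases h : ℓ i ≤ y
    · have hm : max (y - ℓ i) 0 = y - ℓ i := max_eq_left (by linarith)
      rw [hm]
      have h1 : (y - ℓ i) ^ 2 ≤ y ^ 2 := by nlinarith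
      have h2 : (1 : ℝ) ≤ y ^ σ * ℓ i ^ (-σ) := by
        rw [rpow_neg hi.le, ← div_eq_mul_inv, le_div_iff₀ (rpow_pos_of_pos hi σ), one_mul]
        exact rpow_le_rpow hi.le h hσ
      calc (y - ℓ i) ^ 2 / 2 ≤ y ^ 2 / 2 * 1 := by linarith
        _ ≤ y ^ 2 / 2 * (y ^ σ * ℓ i ^ (-σ)) := by gcongr
        _ = y ^ (2 + σ) / 2 * ℓ i ^ (-σ) := by
            rw [rpow_add hy, show (2 : ℝ) = ((2 : ℕ) : ℝ) by norm_num, rpow_natCast]; ring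
    · have hm : max (y - ℓ i) 0 = 0 := max_eq_right (by linarith)
      rw [hm]; norm_num; positivity
  calc a i * ((max (y - ℓ i) 0) ^ 2 / 2) ≤ a i * (y ^ (2 + σ) / 2 * ℓ i ^ (-σ)) :=
        mul_le_mul_of_nonneg_left key (ha i)
    _ = y ^ (2 + σ) / 2 * (a i * ℓ i ^ (-σ)) := by ring

include ha hℓ in
/-- Summability of the weighted indicators. [folklore] -/
theorem summable_indicator {σ : ℝ} (hσ : 0 ≤ σ) (hsum : Summable fun i => a i * ℓ i ^ (-σ)) (x : ℝ) :
    Summable fun i => a i * (if ℓ i ≤ x then (1 : ℝ) else 0) := by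
  by_cases hx : 0 < x
  · exact Summable.of_nonneg_of_le (fun i => mul_nonneg (ha i) (by positivity))
      (fun i => indicator_le ha hℓ hσ hx i) (hsum.mul_left _)
  · have : (fun i => a i * (if ℓ i ≤ x then (1 : ℝ) else 0)) = fun _ => 0 := by
      funext i; rw [if_neg, mul_zero]; intro h; exact hx (by linarith [hℓ i])
    rw [this]; exact summable_zero

include ha hℓ in
/-- Summability of the weighted order-two terms. [folklore] -/
theorem summable_sq_posPart {σ : ℝ} (hσ : 0 ≤ σ) (hsum : Summable fun i => a i * ℓ i ^ (-σ)) (y : ℝ) :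
    Summable fun i => a i * ((max (y - ℓ i) 0) ^ 2 / 2) := by
  by_cases hy : 0 < y
  · exact Summable.of_nonneg_of_le (fun i => mul_nonneg (ha i) (by positivity))
      (fun i => sq_posPart_le ha hℓ hσ hy i) (hsum.mul_left _)
  · have : (fun i => a i * ((max (y - ℓ i) 0) ^ 2 / 2)) = fun _ => 0 := by
      funext i; rw [max_eq_right (by linarith [hℓ i])]; simp
    rw [this]; exact summable_zero

include hℓ in
/-- For the unweighted family (`a ≡ 1`): the set `{i : ℓ_i ≤ x}` is finite. [folklore] -/
theorem finite_le {σ : ℝ} (hσ : 0 ≤ σ) (hsum : Summable fun i => ℓ i ^ (-σ)) (x : ℝ) :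
    {i | ℓ i ≤ x}.Finite := by
  have hs : Summable fun i => (1 : ℝ) * (if ℓ i ≤ x then (1 : ℝ) else 0) :=
    summable_indicator (a := fun _ => 1) (fun _ => zero_le_one) hℓ hσ (by simpa using hsum) x
  simp only [one_mul] at hs
  have h := hs.tendsto_cofinite_zero
  have h1 : ∀ᶠ i in cofinite, (if ℓ i ≤ x then (1 : ℝ) else 0) < 1 / 2 := h (Iio_mem_nhds (by norm_num))
  rw [Filter.eventually_cofinite] at h1
  refine h1.subset fun i hi => ?_
  simp only [Set.mem_setOf_eq] at hi ⊢
  rw [if_pos hi]; norm_num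

include hℓ in
/-- For the unweighted family, `N(x) = #{i : ℓ_i ≤ x}`. [folklore] -/
theorem countFn_one_eq_ncard {σ : ℝ} (hσ : 0 ≤ σ) (hsum : Summable fun i => ℓ i ^ (-σ)) (x : ℝ) :
    countFn (fun _ => 1) ℓ x = ({i | ℓ i ≤ x}.ncard : ℝ) := by
  have hfin := finite_le hℓ hσ hsum x
  rw [countFn, tsum_eq_sum (s := hfin.toFinset) fun i hi => ?_]
  · rw [Finset.sum_congr rfl fun i hi => by rw [if_pos (by simpa using hi), mul_one], Finset.sum_const, nsmul_eq_mul,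
      mul_one, Set.ncard_eq_toFinset_card _ hfin]
  · rw [if_neg (by simpa using hi), mul_zero]

include ha hℓ in
/-- `N` is non-decreasing. [folklore] -/
theorem countFn_mono {σ : ℝ} (hσ : 0 ≤ σ) (hsum : Summable fun i => a i * ℓ i ^ (-σ)) : Monotone (countFn a ℓ) := by
  intro x x' hxx'
  refine (summable_indicator ha hℓ hσ hsum x).tsum_le_tsum (fun i => ?_) (summable_indicator ha hℓ hσ hsum x')
  refine mul_le_mul_of_nonneg_left ?_ (ha i)
  split_ifs with h1 h2 <;> first | rfl | linarith

include ha in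
/-- `N ≥ 0`. [folklore] -/
theorem countFn_nonneg (x : ℝ) : 0 ≤ countFn a ℓ x := tsum_nonneg fun i => mul_nonneg (ha i) (by positivity)

include ha hℓ in
/-- `‖D(σ + it)‖ ≤ Σ_i a_i ℓ_i^{−σ}`. [folklore] -/
theorem norm_dirSeries_le {σ : ℝ} (hsum : Summable fun i => a i * ℓ i ^ (-σ)) (t : ℝ) :
    ‖dirSeries a ℓ ((σ : ℂ) + t * I)‖ ≤ ∑' i, a i * ℓ i ^ (-σ) := by
  have h : ∀ i, ‖(a i : ℂ) * ((ℓ i : ℝ) : ℂ) ^ (-((σ : ℂ) + t * I))‖ = a i * ℓ i ^ (-σ) := fun i => by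
    rw [norm_term ha hℓ]; simp
  refine (norm_tsum_le_tsum_norm ?_).trans (le_of_eq (tsum_congr h))
  exact hsum.congr fun i => (h i).symm

include hℓ in
/-- The terms `t ↦ a_i ℓ_i^{−(σ+it)}` are continuous. [folklore] -/
theorem continuous_term_vertical (i : ι) (σ : ℝ) :
    Continuous fun t : ℝ => (a i : ℂ) * ((ℓ i : ℝ) : ℂ) ^ (-((σ : ℂ) + t * I)) := by
  refine continuous_const.mul (continuous_iff_continuousAt.2 fun t => ?_)
  exact (continuousAt_const_cpow (ofReal_ne_zero.2 (by linarith [hℓ i] : ℓ i ≠ 0))).comp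
    (f := fun t : ℝ => -((σ : ℂ) + t * I)) (by fun_prop)

include ha hℓ in
/-- `t ↦ D(σ + it)` is continuous when `Σ a_i ℓ_i^{−σ} < ∞` (uniform convergence). [folklore] -/
theorem continuous_dirSeries_vertical {σ : ℝ} (hsum : Summable fun i => a i * ℓ i ^ (-σ)) :
    Continuous fun t : ℝ => dirSeries a ℓ ((σ : ℂ) + t * I) := by
  unfold dirSeries
  refine continuous_tsum (fun i => continuous_term_vertical hℓ i σ) hsum fun i t => ?_
  rw [norm_term ha hℓ]; simp

include ha hℓ in
/-- **Perron's formula of order two for the weighted family:** for `y > 0` and `σ > 0` with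
`Σ_i a_i ℓ_i^{−σ} < ∞`, `N₂(y) = Σ_i a_i (y − ℓ_i)₊²/2 = (1/2π) ∫ y^{2+s} D(s) k₂(s) dt`, `s = σ + it`, the
integral converging absolutely. [cite: MontgomeryVaughan2007, §5.1 (Riesz means; kernel of order 2)] -/
theorem riesz2_eq_integral [Countable ι] {y : ℝ} (hy : 0 < y) {σ : ℝ} (hσ : 0 < σ)
    (hsum : Summable fun i => a i * ℓ i ^ (-σ)) :
    ((riesz2 a ℓ y : ℝ) : ℂ) =
      (1 / (2 * π) : ℂ) * ∫ t : ℝ, (y : ℂ) ^ (2 + ((σ : ℂ) + t * I)) * dirSeries a ℓ ((σ : ℂ) + t * I) *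
        kernel2 ((σ : ℂ) + t * I) := by
  have hy0 : (y : ℂ) ≠ 0 := ofReal_ne_zero.2 hy.ne'
  set K : ℝ → ℂ := fun t => kernel2 ((σ : ℂ) + t * I) with hK
  set G : ι → ℝ → ℂ := fun i t => (y : ℂ) ^ (2 + ((σ : ℂ) + t * I)) *
    ((a i : ℂ) * ((ℓ i : ℝ) : ℂ) ^ (-((σ : ℂ) + t * I))) with hG
  set F : ι → ℝ → ℂ := fun i t => G i t * K t with hF
  have hnormG : ∀ i t, ‖G i t‖ = y ^ (2 + σ) * (a i * ℓ i ^ (-σ)) := by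
    intro i t
    simp only [hG, norm_mul]
    rw [norm_cpow_eq_rpow_re_of_pos hy, ← norm_mul, norm_term ha hℓ]
    simp
  have hcontG : ∀ i, Continuous (G i) := by
    intro i
    simp only [hG]
    refine Continuous.mul ?_ (continuous_term_vertical hℓ i σ)
    refine continuous_iff_continuousAt.2 fun t => ?_
    exact (continuousAt_const_cpow hy0).comp (f := fun t : ℝ => 2 + ((σ : ℂ) + t * I)) (by fun_prop)
  have hintK : Integrable K := integrable_kernel2 hσ
  have hintF : ∀ i, Integrable (F i) := fun i =>
    hintK.bdd_mul (hcontG i).aestronglyMeasurable (Eventually.of_forall fun t => (hnormG i t).le)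
  have hsumF : Summable fun i => ∫ t, ‖F i t‖ := by
    have := (hsum.mul_left (y ^ (2 + σ))).mul_right (∫ t : ℝ, ‖K t‖)
    refine this.congr fun i => ?_
    rw [← integral_const_mul]
    refine integral_congr_ae (Eventually.of_forall fun t => ?_)
    simp only [hF, norm_mul, hnormG i t]
  have hterm : ∀ i, (((a i * ((max (y - ℓ i) 0) ^ 2 / 2)) : ℝ) : ℂ) = (1 / (2 * π) : ℂ) * ∫ t, F i t := by
    intro i
    rw [ofReal_mul, sq_posPart_eq_integral hy (by linarith [hℓ i]) hσ, ← mul_assoc, mul_comm (a i : ℂ), mul_assoc,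
      ← integral_const_mul]
    congr 1
    refine integral_congr_ae (Eventually.of_forall fun t => ?_)
    simp only [hF, hG, hK]
    ring
  have hlhs : ((riesz2 a ℓ y : ℝ) : ℂ) = ∑' i, (((a i * ((max (y - ℓ i) 0) ^ 2 / 2)) : ℝ) : ℂ) := by
    rw [riesz2, ofReal_tsum]
  rw [hlhs, tsum_congr hterm, tsum_mul_left, integral_tsum_of_summable_integral_norm hintF hsumF]
  congr 1
  refine integral_congr_ae (Eventually.of_forall fun t => ?_)
  simp only [hF, hG, hK]
  rw [dirSeries, ← tsum_mul_left, ← tsum_mul_right]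

include ha hℓ in
/-- The Perron integrand of `N₂` is integrable. [folklore] -/
theorem integrable_perron2 {y : ℝ} (hy : 0 < y) {σ : ℝ} (hσ : 0 < σ) (hsum : Summable fun i => a i * ℓ i ^ (-σ)) :
    Integrable fun t : ℝ => (y : ℂ) ^ (2 + ((σ : ℂ) + t * I)) * dirSeries a ℓ ((σ : ℂ) + t * I) *
      kernel2 ((σ : ℂ) + t * I) := by
  have hy0 : (y : ℂ) ≠ 0 := ofReal_ne_zero.2 hy.ne'
  have hc : Continuous fun t : ℝ => (y : ℂ) ^ (2 + ((σ : ℂ) + t * I)) * dirSeries a ℓ ((σ : ℂ) + t * I) := by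
    refine Continuous.mul ?_ (continuous_dirSeries_vertical ha hℓ hsum)
    refine continuous_iff_continuousAt.2 fun t => ?_
    exact (continuousAt_const_cpow hy0).comp (f := fun t : ℝ => 2 + ((σ : ℂ) + t * I)) (by fun_prop)
  refine (integrable_kernel2 hσ).bdd_mul hc.aestronglyMeasurable (c := y ^ (2 + σ) * ∑' i, a i * ℓ i ^ (-σ))
    (Eventually.of_forall fun t => ?_)
  rw [norm_mul, norm_cpow_eq_rpow_re_of_pos hy]
  simp only [add_re, ofReal_re, mul_re, I_re, mul_zero, ofReal_im, I_im, mul_one, sub_self, add_zero, re_ofNat]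
  exact mul_le_mul_of_nonneg_left (norm_dirSeries_le ha hℓ hsum t) (by positivity)

end Family

/-! ### Second differences of `(y − u)₊²/2`: the unsmoothing kernel inequalities -/

/-- The second difference `Δ_h² g_u(x) = g_u(x+2h) − 2g_u(x+h) + g_u(x)` of `g_u(y) = (y − u)₊²/2` lies in
`[0, h²]`, equals `h²` if `u ≤ x` and `0` if `u > x + 2h`; hence
`h² 𝟙{u ≤ x} ≤ Δ_h² g_u(x) ≤ h² 𝟙{u ≤ x + 2h}`. [folklore] -/
theorem secondDiff_sq_posPart_bounds (u x : ℝ) {h : ℝ} (hh : 0 < h) :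
    h ^ 2 * (if u ≤ x then (1 : ℝ) else 0) ≤
      (max (x + 2 * h - u) 0) ^ 2 / 2 - 2 * ((max (x + h - u) 0) ^ 2 / 2) + (max (x - u) 0) ^ 2 / 2 ∧
    (max (x + 2 * h - u) 0) ^ 2 / 2 - 2 * ((max (x + h - u) 0) ^ 2 / 2) + (max (x - u) 0) ^ 2 / 2 ≤
      h ^ 2 * (if u ≤ x + 2 * h then (1 : ℝ) else 0) := by
  by_cases h1 : u ≤ x
  · rw [if_pos h1, if_pos (by linarith), max_eq_left (by linarith), max_eq_left (by linarith),
      max_eq_left (by linarith)]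
    constructor <;> nlinarith
  rw [if_neg h1, max_eq_right (by linarith : x - u ≤ 0)]
  by_cases h2 : u ≤ x + h
  · rw [if_pos (by linarith), max_eq_left (by linarith), max_eq_left (by linarith)]
    constructor <;> nlinarith
  rw [max_eq_right (by linarith : x + h - u ≤ 0)]
  by_cases h3 : u ≤ x + 2 * h
  · rw [if_pos h3, max_eq_left (by linarith)]
    constructor <;> nlinarith
  · rw [if_neg h3, max_eq_right (by linarith)]
    norm_num

section FamilySandwich

variable {ι : Type*} {a ℓ : ι → ℝ} (ha : ∀ i, 0 ≤ a i) (hℓ : ∀ i, 1 ≤ ℓ i)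
include ha hℓ

/-- **Unsmoothing sandwich for the family:** `h² N(x) ≤ Δ_h² N₂(x) ≤ h² N(x + 2h)` (`a ≥ 0`, `N` non-decreasing).
[folklore] -/
theorem riesz2_secondDiff_bounds {σ : ℝ} (hσ : 0 ≤ σ) (hsum : Summable fun i => a i * ℓ i ^ (-σ)) (x : ℝ) {h : ℝ}
    (hh : 0 < h) :
    h ^ 2 * countFn a ℓ x ≤ riesz2 a ℓ (x + 2 * h) - 2 * riesz2 a ℓ (x + h) + riesz2 a ℓ x ∧
      riesz2 a ℓ (x + 2 * h) - 2 * riesz2 a ℓ (x + h) + riesz2 a ℓ x ≤ h ^ 2 * countFn a ℓ (x + 2 * h) := by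
  have hs := fun y => summable_sq_posPart ha hℓ hσ hsum y
  have hD : riesz2 a ℓ (x + 2 * h) - 2 * riesz2 a ℓ (x + h) + riesz2 a ℓ x =
      ∑' i, a i * ((max (x + 2 * h - ℓ i) 0) ^ 2 / 2 - 2 * ((max (x + h - ℓ i) 0) ^ 2 / 2) +
        (max (x - ℓ i) 0) ^ 2 / 2) := by
    rw [riesz2, riesz2, riesz2, ← tsum_mul_left, ← (hs _).tsum_sub ((hs _).mul_left 2),
      ← ((hs _).sub ((hs _).mul_left 2)).tsum_add (hs _)]
    exact tsum_congr fun i => by ring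
  have hsD : Summable fun i => a i * ((max (x + 2 * h - ℓ i) 0) ^ 2 / 2 - 2 * ((max (x + h - ℓ i) 0) ^ 2 / 2) +
      (max (x - ℓ i) 0) ^ 2 / 2) :=
    (((hs (x + 2 * h)).sub ((hs (x + h)).mul_left 2)).add (hs x)).congr fun i => by ring
  rw [hD, countFn, countFn, ← tsum_mul_left, ← tsum_mul_left]
  constructor
  · refine ((summable_indicator ha hℓ hσ hsum x).mul_left _).tsum_le_tsum (fun i => ?_) hsD
    have := mul_le_mul_of_nonneg_left (secondDiff_sq_posPart_bounds (ℓ i) x hh).1 (ha i)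
    linarith [this]
  · refine hsD.tsum_le_tsum (fun i => ?_) ((summable_indicator ha hℓ hσ hsum _).mul_left _)
    have := mul_le_mul_of_nonneg_left (secondDiff_sq_posPart_bounds (ℓ i) x hh).2 (ha i)
    linarith [this]

end FamilySandwich

/-! ### The continuous majorant `r u^{δ−1} du` on `(1, ∞)`: count, Riesz mean, Perron integral -/

section Density

variable (r δ : ℝ)

/-- `M(x) = ∫_{(1,∞)} r u^{δ−1} 𝟙{u ≤ x} du` (`= r(x^δ − 1)/δ` for `x ≥ 1`): the counting function of the
measure `r u^{δ−1} du`, whose "Dirichlet series" `∫_1^∞ u^{−s} r u^{δ−1} du = r/(s − δ)` is the pole part.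
[folklore] -/
def densCount (x : ℝ) : ℝ := ∫ u in Ioi (1 : ℝ), r * u ^ (δ - 1) * (if u ≤ x then (1 : ℝ) else 0)

/-- `M₂(y) = ∫_{(1,∞)} r u^{δ−1} (y − u)₊²/2 du`, the order-two Riesz mean of `r u^{δ−1} du`. [folklore] -/
def densRiesz2 (y : ℝ) : ℝ := ∫ u in Ioi (1 : ℝ), r * u ^ (δ - 1) * ((max (y - u) 0) ^ 2 / 2)

variable {r δ}

/-- `u ↦ r u^{δ−1}` is continuous on `[1, Y]`. [folklore] -/
theorem continuousOn_const_mul_rpow (Y : ℝ) : ContinuousOn (fun u : ℝ => r * u ^ (δ - 1)) (Icc 1 Y) := by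
  refine continuousOn_const.mul (ContinuousOn.rpow_const continuousOn_id fun u hu => Or.inl ?_)
  exact ne_of_gt (lt_of_lt_of_le one_pos hu.1)

/-- An integrand `r u^{δ−1} φ(u)` with `φ` continuous and `φ(u) = 0` for `u > Y` is integrable on `(1, ∞)`.
[folklore] -/
theorem integrableOn_of_vanish {φ : ℝ → ℝ} (hφ : Continuous φ) {Y : ℝ} (hY : ∀ u, Y < u → φ u = 0) :
    IntegrableOn (fun u : ℝ => r * u ^ (δ - 1) * φ u) (Ioi 1) := by
  have hsplit : Ioi (1 : ℝ) = Ioc 1 (max Y 1) ∪ Ioi (max Y 1) := (Ioc_union_Ioi_eq_Ioi (le_max_right Y 1)).symm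
  rw [hsplit]
  refine IntegrableOn.union ?_ ?_
  · exact (((continuousOn_const_mul_rpow (max Y 1)).mul hφ.continuousOn).integrableOn_Icc).mono_set
      Ioc_subset_Icc_self
  · refine integrableOn_zero.congr_fun (fun u hu => ?_) measurableSet_Ioi
    show (0 : ℝ) = r * u ^ (δ - 1) * φ u
    rw [hY u (lt_of_le_of_lt (le_max_left _ _) hu), mul_zero]

/-- The `M₂` integrand is integrable on `(1, ∞)`. [folklore] -/
theorem integrableOn_densRiesz2 (y : ℝ) :
    IntegrableOn (fun u : ℝ => r * u ^ (δ - 1) * ((max (y - u) 0) ^ 2 / 2)) (Ioi 1) := by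
  refine integrableOn_of_vanish (φ := fun u => (max (y - u) 0) ^ 2 / 2) (by fun_prop) (Y := y) fun u hu => ?_
  show (max (y - u) 0) ^ 2 / 2 = 0
  rw [max_eq_right (by linarith)]; norm_num

/-- The `M` integrand as an indicator. [folklore] -/
theorem densCount_integrand_eq (x : ℝ) :
    (fun u : ℝ => r * u ^ (δ - 1) * (if u ≤ x then (1 : ℝ) else 0)) =
      (Iic x).indicator fun u : ℝ => r * u ^ (δ - 1) := by
  funext u
  by_cases hu : u ≤ x
  · rw [if_pos hu, Set.indicator_of_mem (show u ∈ Iic x from hu), mul_one]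
  · rw [if_neg hu, Set.indicator_of_notMem (show u ∉ Iic x from hu), mul_zero]

/-- The `M` integrand is integrable on `(1, ∞)`. [folklore] -/
theorem integrableOn_densCount (x : ℝ) :
    IntegrableOn (fun u : ℝ => r * u ^ (δ - 1) * (if u ≤ x then (1 : ℝ) else 0)) (Ioi 1) := by
  rw [densCount_integrand_eq, IntegrableOn, integrable_indicator_iff measurableSet_Iic, IntegrableOn,
    Measure.restrict_restrict measurableSet_Iic, Iic_inter_Ioi]
  exact ((continuousOn_const_mul_rpow x).integrableOn_Icc).mono_set Ioc_subset_Icc_self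

/-- **`M(x) = r(x^δ − 1)/δ`** for `x ≥ 1`. [folklore] -/
theorem densCount_eq (hδ : 0 < δ) {x : ℝ} (hx : 1 ≤ x) : densCount r δ x = r * (x ^ δ - 1) / δ := by
  unfold densCount
  rw [densCount_integrand_eq, setIntegral_indicator measurableSet_Iic, Ioi_inter_Iic,
    ← intervalIntegral.integral_of_le hx, intervalIntegral.integral_const_mul, integral_rpow (Or.inl (by linarith)),
    sub_add_cancel, one_rpow]
  ring

/-- `M` is non-decreasing in `x` (for `r ≥ 0`). [folklore] -/
theorem densCount_mono (hr : 0 ≤ r) : Monotone (densCount r δ) := by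
  intro x x' hxx'
  unfold densCount
  refine setIntegral_mono_on (integrableOn_densCount x) (integrableOn_densCount x') measurableSet_Ioi
    fun u hu => ?_
  have hu0 : 0 ≤ r * u ^ (δ - 1) := mul_nonneg hr (rpow_nonneg (by linarith [hu.out]) _)
  split_ifs with h1 h2 <;> first | rfl | linarith

/-- **Unsmoothing sandwich for the majorant:** `h² M(x) ≤ Δ_h² M₂(x) ≤ h² M(x + 2h)` (`r ≥ 0`). [folklore] -/
theorem densRiesz2_secondDiff_bounds (hr : 0 ≤ r) (x : ℝ) {h : ℝ} (hh : 0 < h) :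
    h ^ 2 * densCount r δ x ≤ densRiesz2 r δ (x + 2 * h) - 2 * densRiesz2 r δ (x + h) + densRiesz2 r δ x ∧
      densRiesz2 r δ (x + 2 * h) - 2 * densRiesz2 r δ (x + h) + densRiesz2 r δ x ≤
        h ^ 2 * densCount r δ (x + 2 * h) := by
  have hI := fun y => integrableOn_densRiesz2 (r := r) (δ := δ) y
  have hX : Integrable (fun u : ℝ => r * u ^ (δ - 1) * ((max (x + 2 * h - u) 0) ^ 2 / 2) -
      2 * (r * u ^ (δ - 1) * ((max (x + h - u) 0) ^ 2 / 2))) (volume.restrict (Ioi 1)) :=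
    (hI _).sub ((hI _).const_mul 2)
  have hID : Integrable (fun u : ℝ => r * u ^ (δ - 1) * ((max (x + 2 * h - u) 0) ^ 2 / 2) -
      2 * (r * u ^ (δ - 1) * ((max (x + h - u) 0) ^ 2 / 2)) + r * u ^ (δ - 1) * ((max (x - u) 0) ^ 2 / 2))
      (volume.restrict (Ioi 1)) := hX.add (hI x)
  have hD : densRiesz2 r δ (x + 2 * h) - 2 * densRiesz2 r δ (x + h) + densRiesz2 r δ x =
      ∫ u in Ioi (1 : ℝ), r * u ^ (δ - 1) * ((max (x + 2 * h - u) 0) ^ 2 / 2) -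
        2 * (r * u ^ (δ - 1) * ((max (x + h - u) 0) ^ 2 / 2)) + r * u ^ (δ - 1) * ((max (x - u) 0) ^ 2 / 2) := by
    unfold densRiesz2
    rw [integral_add hX (hI _), integral_sub (hI _) ((hI _).const_mul 2), integral_const_mul]
  rw [hD, densCount, densCount, ← integral_const_mul, ← integral_const_mul]
  constructor
  · refine setIntegral_mono_on ((integrableOn_densCount x).const_mul _) hID measurableSet_Ioi fun u hu => ?_
    have hu0 : 0 ≤ r * u ^ (δ - 1) := mul_nonneg hr (rpow_nonneg (by linarith [hu.out]) _)
    have := (secondDiff_sq_posPart_bounds u x hh).1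
    calc h ^ 2 * (r * u ^ (δ - 1) * (if u ≤ x then (1 : ℝ) else 0))
        = r * u ^ (δ - 1) * (h ^ 2 * (if u ≤ x then (1 : ℝ) else 0)) := by ring
      _ ≤ r * u ^ (δ - 1) * ((max (x + 2 * h - u) 0) ^ 2 / 2 - 2 * ((max (x + h - u) 0) ^ 2 / 2) +
          (max (x - u) 0) ^ 2 / 2) := mul_le_mul_of_nonneg_left this hu0
      _ = _ := by ring
  · refine setIntegral_mono_on hID ((integrableOn_densCount _).const_mul _) measurableSet_Ioi fun u hu => ?_
    have hu0 : 0 ≤ r * u ^ (δ - 1) := mul_nonneg hr (rpow_nonneg (by linarith [hu.out]) _)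
    have := (secondDiff_sq_posPart_bounds u x hh).2
    calc r * u ^ (δ - 1) * ((max (x + 2 * h - u) 0) ^ 2 / 2) - 2 * (r * u ^ (δ - 1) * ((max (x + h - u) 0) ^ 2 / 2)) +
          r * u ^ (δ - 1) * ((max (x - u) 0) ^ 2 / 2)
        = r * u ^ (δ - 1) * ((max (x + 2 * h - u) 0) ^ 2 / 2 - 2 * ((max (x + h - u) 0) ^ 2 / 2) +
          (max (x - u) 0) ^ 2 / 2) := by ring
      _ ≤ r * u ^ (δ - 1) * (h ^ 2 * (if u ≤ x + 2 * h then (1 : ℝ) else 0)) := mul_le_mul_of_nonneg_left this hu0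
      _ = _ := by ring

/-- `∫_{(1,∞)} u^{δ−1−s} du = 1/(s − δ)` for `Re s > δ`: the "Dirichlet series" of `u^{δ−1} du`. [folklore] -/
theorem integral_Ioi_cpow_dens {s : ℂ} (hs : δ < s.re) :
    ∫ u in Ioi (1 : ℝ), (u : ℂ) ^ ((δ : ℂ) - 1 - s) = 1 / (s - δ) := by
  have hne : (s - δ : ℂ) ≠ 0 := fun h => by have := congrArg re h; simp at this; linarith
  have hne' : ((δ : ℂ) - 1 - s + 1) ≠ 0 := by
    intro h; apply hne; linear_combination -h
  rw [integral_Ioi_cpow_of_lt (a := (δ : ℂ) - 1 - s) (by simp; linarith) one_pos, ofReal_one, one_cpow]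
  field_simp
  ring

/-- **Perron's formula of order two for the majorant:** for `y > 0` and `σ > δ > 0`,
`M₂(y) = (1/2π) ∫ y^{2+s} · r/(s − δ) · k₂(s) dt`, `s = σ + it` (one-term identity integrated against
`r u^{δ−1} du`, Fubini). [folklore] -/
theorem densRiesz2_eq_integral (hδ : 0 < δ) {y : ℝ} (hy : 0 < y) {σ : ℝ} (hσ : δ < σ) :
    ((densRiesz2 r δ y : ℝ) : ℂ) =
      (1 / (2 * π) : ℂ) * ∫ t : ℝ, (y : ℂ) ^ (2 + ((σ : ℂ) + t * I)) * ((r : ℂ) / (((σ : ℂ) + t * I) - δ)) *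
        kernel2 ((σ : ℂ) + t * I) := by
  have hσ0 : 0 < σ := hδ.trans hσ
  have hy0 : (y : ℂ) ≠ 0 := ofReal_ne_zero.2 hy.ne'
  set c : ℂ := (1 / (2 * π) : ℂ) with hc
  -- the two-variable integrand
  set F : ℝ × ℝ → ℂ := fun p => ((r * p.1 ^ (δ - 1) : ℝ) : ℂ) * ((y : ℂ) ^ (2 + ((σ : ℂ) + p.2 * I)) *
      (p.1 : ℂ) ^ (-((σ : ℂ) + p.2 * I)) * kernel2 ((σ : ℂ) + p.2 * I)) with hF
  -- Step 1: insert the one-term identity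
  have h1 : ((densRiesz2 r δ y : ℝ) : ℂ) = ∫ u in Ioi (1 : ℝ), ∫ t : ℝ, c * F (u, t) := by
    rw [densRiesz2, ← integral_complex_ofReal]
    refine setIntegral_congr_fun measurableSet_Ioi fun u hu => ?_
    have hu : 0 < u := zero_lt_one.trans hu
    rw [ofReal_mul, sq_posPart_eq_integral hy hu hσ0, ← integral_const_mul, ← integral_const_mul]
    refine integral_congr_ae (Eventually.of_forall fun t => ?_)
    simp only [hF]
    ring
  -- Step 2: integrability on the product
  have hmeasF : Measurable F := by
    simp only [hF]
    have hk : Measurable fun p : ℝ × ℝ => kernel2 ((σ : ℂ) + p.2 * I) :=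
      (continuous_kernel2_vertical hσ0).measurable.comp measurable_snd
    have he : Measurable fun p : ℝ × ℝ => -((σ : ℂ) + p.2 * I) := by fun_prop
    have he' : Measurable fun p : ℝ × ℝ => 2 + ((σ : ℂ) + p.2 * I) := by fun_prop
    have hb : Measurable fun p : ℝ × ℝ => ((p.1 : ℝ) : ℂ) := measurable_ofReal.comp measurable_fst
    have hr' : Measurable fun p : ℝ × ℝ => ((r * p.1 ^ (δ - 1) : ℝ) : ℂ) :=
      measurable_ofReal.comp ((measurable_fst.pow_const _).const_mul _)
    exact hr'.mul (((measurable_const.pow he').mul (hb.pow he)).mul hk)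
  have hbound : ∀ p : ℝ × ℝ, p.1 ∈ Ioi (1 : ℝ) →
      ‖F p‖ ≤ (|r| * p.1 ^ (δ - 1 - σ)) * (y ^ (2 + σ) * ‖kernel2 ((σ : ℂ) + p.2 * I)‖) := by
    intro p hp
    have hu : 0 < p.1 := zero_lt_one.trans hp
    simp only [hF, norm_mul, Complex.norm_real, Real.norm_eq_abs, abs_of_nonneg (rpow_nonneg hu.le (δ - 1))]
    rw [norm_cpow_eq_rpow_re_of_pos hy, norm_cpow_eq_rpow_re_of_pos hu]
    simp only [add_re, neg_re, ofReal_re, mul_re, I_re, mul_zero, ofReal_im, I_im, mul_one, sub_self, add_zero,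
      re_ofNat]
    rw [show δ - 1 - σ = (δ - 1) + (-σ) by ring, rpow_add hu]
    apply le_of_eq; ring
  have hG : Integrable (fun p : ℝ × ℝ => (|r| * p.1 ^ (δ - 1 - σ)) * (y ^ (2 + σ) * ‖kernel2 ((σ : ℂ) + p.2 * I)‖))
      ((volume.restrict (Ioi (1 : ℝ))).prod volume) := by
    refine Integrable.mul_prod (f := fun u : ℝ => |r| * u ^ (δ - 1 - σ))
      (g := fun t : ℝ => y ^ (2 + σ) * ‖kernel2 ((σ : ℂ) + t * I)‖) ?_ ?_
    · exact ((integrableOn_Ioi_rpow_of_lt (by linarith) one_pos).const_mul _)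
    · exact (integrable_kernel2 hσ0).norm.const_mul _
  have hintF : Integrable F ((volume.restrict (Ioi (1 : ℝ))).prod volume) := by
    refine hG.mono' hmeasF.aestronglyMeasurable ?_
    rw [Measure.restrict_prod_eq_prod_univ, ae_restrict_iff' (measurableSet_Ioi.prod MeasurableSet.univ)]
    exact Eventually.of_forall fun p hp => hbound p hp.1
  -- Step 3: swap the integrals
  have hswap : ∫ u in Ioi (1 : ℝ), ∫ t : ℝ, c * F (u, t) = ∫ t : ℝ, ∫ u in Ioi (1 : ℝ), c * F (u, t) :=
    integral_integral_swap (hintF.const_mul c)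
  rw [h1, hswap, ← integral_const_mul]
  refine integral_congr_ae (Eventually.of_forall fun t => ?_)
  beta_reduce
  -- Step 4: the inner integral
  set s : ℂ := (σ : ℂ) + t * I with hs
  have hsre : δ < s.re := by simp [hs]; linarith
  have hinner : ∫ u in Ioi (1 : ℝ), c * F (u, t) =
      c * ((y : ℂ) ^ (2 + s) * kernel2 s * (r : ℂ)) * ∫ u in Ioi (1 : ℝ), (u : ℂ) ^ ((δ : ℂ) - 1 - s) := by
    rw [← integral_const_mul]
    refine setIntegral_congr_fun measurableSet_Ioi fun u hu => ?_
    have hu : 0 < u := zero_lt_one.trans hu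
    have hu0 : (u : ℂ) ≠ 0 := ofReal_ne_zero.2 hu.ne'
    simp only [hF]
    rw [ofReal_mul, ofReal_cpow hu.le, show ((δ : ℂ) - 1 - s) = ((δ - 1 : ℝ) : ℂ) + (-s) by push_cast; ring,
      cpow_add _ _ hu0]
    ring
  rw [hinner, integral_Ioi_cpow_dens hsre]
  simp only [hs]
  ring

end Density


/-! ### The Perron integral of the holomorphic part and the shift of the line of integration -/

section Shift

variable {H : ℂ → ℂ}

/-- Continuity of `t ↦ H(σ + it)` for `H` holomorphic on `Re s > σ₀`, `σ > σ₀`. [folklore] -/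
theorem continuous_vertical_of_differentiableOn {σ₀ σ : ℝ} (hσ : σ₀ < σ)
    (hH : DifferentiableOn ℂ H {s : ℂ | σ₀ < s.re}) : Continuous fun t : ℝ => H ((σ : ℂ) + t * I) :=
  hH.continuousOn.comp_continuous (by fun_prop) fun t => by simp; linarith

/-- **Integrability and size of the Perron integrand of the holomorphic part:** if
`‖H(σ + it)‖ ≤ M(1 + |t|)^κ` with `κ < 2`, then `t ↦ y^{2+s} H(s) k₂(s)` (`s = σ + it`) is integrable and
`∫ ‖y^{2+s} H(s) k₂(s)‖ dt ≤ y^{2+σ} M (8/min(σ,1)) ∫ (1+|t|)^{κ−3} dt`. [folklore] -/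
theorem integrable_holPart {σ M κ y : ℝ} (hσ : 0 < σ) (hy : 0 < y) (hκ : κ < 2) (hM : 0 ≤ M)
    (hHc : Continuous fun t : ℝ => H ((σ : ℂ) + t * I))
    (hHb : ∀ t : ℝ, ‖H ((σ : ℂ) + t * I)‖ ≤ M * (1 + |t|) ^ κ) :
    Integrable (fun t : ℝ => (y : ℂ) ^ (2 + ((σ : ℂ) + t * I)) * H ((σ : ℂ) + t * I) * kernel2 ((σ : ℂ) + t * I)) ∧
      ∫ t : ℝ, ‖(y : ℂ) ^ (2 + ((σ : ℂ) + t * I)) * H ((σ : ℂ) + t * I) * kernel2 ((σ : ℂ) + t * I)‖ ≤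
        y ^ (2 + σ) * M * (8 / min σ 1 * ∫ t : ℝ, (1 + |t|) ^ (-(3 - κ))) := by
  have hy0 : (y : ℂ) ≠ 0 := ofReal_ne_zero.2 hy.ne'
  obtain ⟨hwi, hwb⟩ := integrable_weight_mul_norm_kernel2 hσ hκ
  have hmeas : AEStronglyMeasurable (fun t : ℝ => (y : ℂ) ^ (2 + ((σ : ℂ) + t * I)) * H ((σ : ℂ) + t * I) *
      kernel2 ((σ : ℂ) + t * I)) volume := by
    refine ((Continuous.mul ?_ hHc).mul (continuous_kernel2_vertical hσ)).aestronglyMeasurable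
    refine continuous_iff_continuousAt.2 fun t => ?_
    exact (continuousAt_const_cpow hy0).comp (f := fun t : ℝ => 2 + ((σ : ℂ) + t * I)) (by fun_prop)
  have hpt : ∀ t : ℝ, ‖(y : ℂ) ^ (2 + ((σ : ℂ) + t * I)) * H ((σ : ℂ) + t * I) * kernel2 ((σ : ℂ) + t * I)‖ ≤
      y ^ (2 + σ) * M * ((1 + |t|) ^ κ * ‖kernel2 ((σ : ℂ) + t * I)‖) := by
    intro t
    rw [norm_mul, norm_mul, norm_cpow_eq_rpow_re_of_pos hy]
    simp only [add_re, ofReal_re, mul_re, I_re, mul_zero, ofReal_im, I_im, mul_one, sub_self, add_zero, re_ofNat]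
    have h1 := hHb t
    have h2 : 0 ≤ y ^ (2 + σ) := by positivity
    calc y ^ (2 + σ) * ‖H ((σ : ℂ) + t * I)‖ * ‖kernel2 ((σ : ℂ) + t * I)‖
        ≤ y ^ (2 + σ) * (M * (1 + |t|) ^ κ) * ‖kernel2 ((σ : ℂ) + t * I)‖ := by gcongr
      _ = _ := by ring
  have hint : Integrable (fun t : ℝ => (y : ℂ) ^ (2 + ((σ : ℂ) + t * I)) * H ((σ : ℂ) + t * I) *
      kernel2 ((σ : ℂ) + t * I)) :=
    (hwi.const_mul (y ^ (2 + σ) * M)).mono' hmeas (Eventually.of_forall hpt)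
  refine ⟨hint, ?_⟩
  calc ∫ t : ℝ, ‖(y : ℂ) ^ (2 + ((σ : ℂ) + t * I)) * H ((σ : ℂ) + t * I) * kernel2 ((σ : ℂ) + t * I)‖
      ≤ ∫ t : ℝ, y ^ (2 + σ) * M * ((1 + |t|) ^ κ * ‖kernel2 ((σ : ℂ) + t * I)‖) :=
        integral_mono hint.norm (hwi.const_mul _) hpt
    _ = y ^ (2 + σ) * M * ∫ t : ℝ, (1 + |t|) ^ κ * ‖kernel2 ((σ : ℂ) + t * I)‖ := integral_const_mul _ _
    _ ≤ y ^ (2 + σ) * M * (8 / min σ 1 * ∫ t : ℝ, (1 + |t|) ^ (-(3 - κ))) := by gcongr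

/-- **Shifting the line of integration** of `∫ y^{2+s} H(s) k₂(s) ds` from `Re s = σ₂` to `Re s = σ₁` for `H`
holomorphic on `Re s > σ₀` (`0 ≤ σ₀ < σ₁ ≤ σ₂`) with `‖H(u+it)‖ ≤ M(1+|t|)^κ` on the closed strip, `κ < 2`, `y ≥ 1`
(pole-free strip: `DMV.integral_line_eq_of_tendsto`; the horizontal sides are `O((1+|T|)^{κ−3}) → 0`).
[cite: MageeOhWinter2019, §3.4 ("We can shift the contour to `ℜ(s) = δ − ε'`")] -/
theorem integral_holPart_shift {σ₀ σ₁ σ₂ M κ y : ℝ} (hσ₀ : 0 ≤ σ₀) (hσ₀₁ : σ₀ < σ₁) (hσ₁₂ : σ₁ ≤ σ₂)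
    (hy : 1 ≤ y) (hκ : κ < 2) (hM : 0 ≤ M) (hH : DifferentiableOn ℂ H {s : ℂ | σ₀ < s.re})
    (hHb : ∀ u : ℝ, σ₁ ≤ u → u ≤ σ₂ → ∀ t : ℝ, ‖H ((u : ℂ) + t * I)‖ ≤ M * (1 + |t|) ^ κ) :
    ∫ t : ℝ, (y : ℂ) ^ (2 + ((σ₂ : ℂ) + t * I)) * H ((σ₂ : ℂ) + t * I) * kernel2 ((σ₂ : ℂ) + t * I) =
      ∫ t : ℝ, (y : ℂ) ^ (2 + ((σ₁ : ℂ) + t * I)) * H ((σ₁ : ℂ) + t * I) * kernel2 ((σ₁ : ℂ) + t * I) := by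
  have hσ₁ : 0 < σ₁ := lt_of_le_of_lt hσ₀ hσ₀₁
  have hσ₂ : 0 < σ₂ := lt_of_lt_of_le hσ₁ hσ₁₂
  have hy0 : 0 < y := by linarith
  have hyC : (y : ℂ) ≠ 0 := ofReal_ne_zero.2 hy0.ne'
  set Φ : ℂ → ℂ := fun s => (y : ℂ) ^ (2 + s) * H s * kernel2 s with hΦ
  -- holomorphy on the closed rectangles
  have hdiff : ∀ T : ℝ, DifferentiableOn ℂ Φ (uIcc σ₁ σ₂ ×ℂ uIcc (-T) T) := by
    intro T s hs
    rw [mem_reProdIm, uIcc_of_le hσ₁₂] at hs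
    have hsre : σ₀ < s.re := lt_of_lt_of_le hσ₀₁ hs.1.1
    have hs0 : 0 < s.re := lt_of_le_of_lt hσ₀ hsre
    refine DifferentiableAt.differentiableWithinAt ?_
    refine DifferentiableAt.mul (DifferentiableAt.mul ?_ ?_) (differentiableAt_kernel2 hs0)
    · exact (differentiableAt_id.const_add _).const_cpow (Or.inl hyC)
    · exact hH.differentiableAt ((isOpen_lt continuous_const continuous_re).mem_nhds hsre)
  -- integrability on the two lines
  have hint₂ : Integrable fun t : ℝ => Φ ((σ₂ : ℂ) + t * I) :=
    (integrable_holPart hσ₂ hy0 hκ hM (continuous_vertical_of_differentiableOn (lt_of_lt_of_le hσ₀₁ hσ₁₂) hH)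
      (hHb σ₂ hσ₁₂ le_rfl)).1
  have hint₁ : Integrable fun t : ℝ => Φ ((σ₁ : ℂ) + t * I) :=
    (integrable_holPart hσ₁ hy0 hκ hM (continuous_vertical_of_differentiableOn hσ₀₁ hH) (hHb σ₁ le_rfl hσ₁₂)).1
  -- decay on the horizontal sides
  set g : ℝ → ℝ := fun T => y ^ (2 + σ₂) * M * (8 / min σ₁ 1) * (1 + T) ^ (-(3 - κ)) with hg
  have hm : 0 < min σ₁ 1 := lt_min hσ₁ one_pos
  have hbound : ∀ T : ℝ, 0 ≤ |T| → ∀ u ∈ Icc σ₁ σ₂, ‖Φ ((u : ℂ) + T * I)‖ ≤ g |T| := by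
    intro T _ u hu
    have hu0 : 0 < u := lt_of_lt_of_le hσ₁ hu.1
    have h1 : (0 : ℝ) < 1 + |T| := by positivity
    simp only [hΦ, hg, norm_mul]
    rw [norm_cpow_eq_rpow_re_of_pos hy0]
    simp only [add_re, ofReal_re, mul_re, I_re, mul_zero, ofReal_im, I_im, mul_one, sub_self, add_zero, re_ofNat]
    have hyu : y ^ (2 + u) ≤ y ^ (2 + σ₂) := rpow_le_rpow_of_exponent_le hy (by linarith [hu.2])
    have hHu := hHb u hu.1 hu.2 T
    have hku : ‖kernel2 ((u : ℂ) + T * I)‖ ≤ 8 / min σ₁ 1 * (1 + |T|) ^ (-(3 : ℝ)) := by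
      refine (norm_kernel2_le' hu0 T).trans ?_
      gcongr
      · exact hu.1
    have hexp : (1 + |T|) ^ κ * (1 + |T|) ^ (-(3 : ℝ)) = (1 + |T|) ^ (-(3 - κ)) := by
      rw [← rpow_add h1]; ring_nf
    calc y ^ (2 + u) * ‖H ((u : ℂ) + T * I)‖ * ‖kernel2 ((u : ℂ) + T * I)‖
        ≤ y ^ (2 + σ₂) * (M * (1 + |T|) ^ κ) * (8 / min σ₁ 1 * (1 + |T|) ^ (-(3 : ℝ))) := by
          gcongr
      _ = y ^ (2 + σ₂) * M * (8 / min σ₁ 1) * ((1 + |T|) ^ κ * (1 + |T|) ^ (-(3 : ℝ))) := by ring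
      _ = y ^ (2 + σ₂) * M * (8 / min σ₁ 1) * (1 + |T|) ^ (-(3 - κ)) := by rw [hexp]
  have hglim : Tendsto g atTop (𝓝 0) := by
    have h := ((tendsto_rpow_neg_atTop (by linarith : (0 : ℝ) < 3 - κ)).comp
      (tendsto_atTop_add_const_left atTop 1 tendsto_id)).const_mul (y ^ (2 + σ₂) * M * (8 / min σ₁ 1))
    rw [mul_zero] at h
    exact h
  obtain ⟨htop, hbot⟩ := Literature.NumberTheory.BeurlingPrimes.DMV.tendsto_horizontal_of_bound hσ₁₂ hbound hglim
  exact Literature.NumberTheory.BeurlingPrimes.DMV.integral_line_eq_of_tendsto hdiff hint₂ hint₁ htop hbot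

end Shift

/-! ### Assembly: the power-saving count -/

/-- The constant of the shifted integral: `S(σ₁, κ) = (8/min(σ₁,1)) ∫ (1+|t|)^{κ−3} dt`. [folklore] -/
def shiftConst (σ₁ κ : ℝ) : ℝ := 8 / min σ₁ 1 * ∫ t : ℝ, (1 + |t|) ^ (-(3 - κ))

/-- `S(σ₁, κ) ≥ 0`. [folklore] -/
theorem shiftConst_nonneg {σ₁ κ : ℝ} (hσ₁ : 0 < σ₁) : 0 ≤ shiftConst σ₁ κ := by
  unfold shiftConst
  have : 0 < min σ₁ 1 := lt_min hσ₁ one_pos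
  exact mul_nonneg (by positivity) (integral_nonneg fun t => by positivity)

section Main

variable {ι : Type*} [Countable ι] {a ℓ : ι → ℝ} (ha : ∀ i, 0 ≤ a i) (hℓ : ∀ i, 1 ≤ ℓ i)
include ha hℓ

/-- **The error function `E = N₂ − M₂` is a shifted Perron integral of the holomorphic part, and is small:**
under the continuation hypothesis `D(s) = r/(s−δ) + H(s)` (`Re s > δ`) with `‖H(u+it)‖ ≤ M(1+|t|)^κ` on
`σ₁ ≤ u ≤ δ+1` (`κ < 2`), for `y ≥ 1`: `|N₂(y) − M₂(y)| ≤ (1/2π) y^{2+σ₁} M S(σ₁,κ)`.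
[cite: MageeOhWinter2019, §3.4 Lemma 15 (the analogous bound `e^{a(δ−ε')}(κ₁ q^C + κ₂ λ^{-2})`)] -/
theorem abs_riesz2_sub_densRiesz2_le {δ : ℝ} (hδ : 0 < δ) (hsum : ∀ σ : ℝ, δ < σ → Summable fun i => a i * ℓ i ^ (-σ))
    {r σ₀ σ₁ : ℝ} (hσ₀ : 0 ≤ σ₀) (hσ₀₁ : σ₀ < σ₁) (hσ₁ : σ₁ < δ)
    {H : ℂ → ℂ} (hH : DifferentiableOn ℂ H {s : ℂ | σ₀ < s.re})
    (hD : ∀ s : ℂ, δ < s.re → dirSeries a ℓ s = r / (s - δ) + H s)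
    {κ M : ℝ} (hκ : κ < 2) (hM : 0 ≤ M)
    (hHb : ∀ u : ℝ, σ₁ ≤ u → u ≤ δ + 1 → ∀ t : ℝ, ‖H ((u : ℂ) + t * I)‖ ≤ M * (1 + |t|) ^ κ)
    {y : ℝ} (hy : 1 ≤ y) :
    |riesz2 a ℓ y - densRiesz2 r δ y| ≤ 1 / (2 * π) * (y ^ (2 + σ₁) * M * shiftConst σ₁ κ) := by
  have hy0 : 0 < y := by linarith
  have hσ₁0 : 0 < σ₁ := lt_of_le_of_lt hσ₀ hσ₀₁
  have hσ₂ : δ < δ + 1 := by linarith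
  have hσ₂0 : 0 < δ + 1 := by linarith
  -- the three Perron integrands on `Re s = δ + 1`
  set ΦD : ℝ → ℂ := fun t => (y : ℂ) ^ (2 + (((δ + 1 : ℝ) : ℂ) + t * I)) * dirSeries a ℓ (((δ + 1 : ℝ) : ℂ) + t * I) *
    kernel2 (((δ + 1 : ℝ) : ℂ) + t * I) with hΦD
  set ΦH : ℝ → ℂ := fun t => (y : ℂ) ^ (2 + (((δ + 1 : ℝ) : ℂ) + t * I)) * H (((δ + 1 : ℝ) : ℂ) + t * I) *
    kernel2 (((δ + 1 : ℝ) : ℂ) + t * I) with hΦH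
  set ΦP : ℝ → ℂ := fun t => (y : ℂ) ^ (2 + (((δ + 1 : ℝ) : ℂ) + t * I)) *
    ((r : ℂ) / ((((δ + 1 : ℝ) : ℂ) + t * I) - δ)) * kernel2 (((δ + 1 : ℝ) : ℂ) + t * I) with hΦP
  have hP1 : ((riesz2 a ℓ y : ℝ) : ℂ) = (1 / (2 * π) : ℂ) * ∫ t, ΦD t :=
    riesz2_eq_integral ha hℓ hy0 hσ₂0 (hsum _ hσ₂)
  have hP2 : ((densRiesz2 r δ y : ℝ) : ℂ) = (1 / (2 * π) : ℂ) * ∫ t, ΦP t := densRiesz2_eq_integral hδ hy0 hσ₂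
  have hID : Integrable ΦD := integrable_perron2 ha hℓ hy0 hσ₂0 (hsum _ hσ₂)
  have hIH : Integrable ΦH := (integrable_holPart hσ₂0 hy0 hκ hM
    (continuous_vertical_of_differentiableOn (by linarith) hH) (hHb _ (by linarith) le_rfl)).1
  have hpt : ∀ t, ΦP t = ΦD t - ΦH t := by
    intro t
    simp only [hΦP, hΦD, hΦH]
    rw [hD _ (by simp)]
    ring
  have hE : (((riesz2 a ℓ y - densRiesz2 r δ y : ℝ)) : ℂ) = (1 / (2 * π) : ℂ) * ∫ t, ΦH t := by
    rw [ofReal_sub, hP1, hP2, integral_congr_ae (Eventually.of_forall hpt), integral_sub hID hIH]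
    ring
  -- shift to `Re s = σ₁`
  have hshift := integral_holPart_shift (y := y) hσ₀ hσ₀₁ (le_of_lt (by linarith : σ₁ < δ + 1)) hy hκ hM hH hHb
  have hbd := (integrable_holPart hσ₁0 hy0 hκ hM (continuous_vertical_of_differentiableOn hσ₀₁ hH)
    (hHb _ le_rfl (by linarith))).2
  have hc : ‖(1 / (2 * π) : ℂ)‖ = 1 / (2 * π) := by
    rw [show (1 / (2 * π) : ℂ) = ((1 / (2 * π) : ℝ) : ℂ) by push_cast; ring, Complex.norm_real, Real.norm_eq_abs,
      abs_of_pos (by positivity)]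
  rw [← Real.norm_eq_abs, ← Complex.norm_real, hE, norm_mul, hc]
  refine mul_le_mul_of_nonneg_left ?_ (by positivity)
  have hshift' : ∫ t, ΦH t = ∫ t : ℝ, (y : ℂ) ^ (2 + ((σ₁ : ℂ) + t * I)) * H ((σ₁ : ℂ) + t * I) *
      kernel2 ((σ₁ : ℂ) + t * I) := by
    simp only [hΦH]; push_cast at hshift ⊢; exact hshift
  rw [hshift']
  refine (norm_integral_le_integral_norm _).trans (hbd.trans (le_of_eq ?_))
  rw [shiftConst]

omit [Countable ι] ha hℓ in
/-- A mean-value bound: for `x/2 ≤ a ≤ b ≤ 2x` (`x > 0`) and `δ > 0`,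
`(b^δ − a^δ)/δ = ∫_a^b u^{δ−1} du ≤ 2^{δ+1} x^{δ−1} (b − a)`. [folklore] -/
theorem rpow_sub_rpow_div_le {δ x a b : ℝ} (hδ : 0 < δ) (hx : 0 < x) (ha : x / 2 ≤ a) (hab : a ≤ b) (hb : b ≤ 2 * x) :
    (b ^ δ - a ^ δ) / δ ≤ 2 ^ (δ + 1) * x ^ (δ - 1) * (b - a) := by
  have ha0 : 0 < a := by linarith
  have hint : ∫ u in a..b, u ^ (δ - 1) = (b ^ δ - a ^ δ) / δ := by
    rw [integral_rpow (Or.inl (by linarith))]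
    simp only [sub_add_cancel]
  -- bound for the integrand on `[a, b] ⊆ [x/2, 2x]`
  have hsup : ∀ u ∈ Ι a b, ‖u ^ (δ - 1)‖ ≤ 2 ^ (δ + 1) * x ^ (δ - 1) := by
    intro u hu
    rw [uIoc_of_le hab] at hu
    have hu0 : 0 < u := by linarith [hu.1]
    rw [Real.norm_eq_abs, abs_of_nonneg (rpow_nonneg hu0.le _)]
    have h2 : (1 : ℝ) ≤ 2 := by norm_num
    rcases le_or_gt 1 δ with hδ1 | hδ1
    · -- `δ ≥ 1`: `u^{δ-1} ≤ (2x)^{δ-1} = 2^{δ-1} x^{δ-1} ≤ 2^{δ+1} x^{δ-1}`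
      calc u ^ (δ - 1) ≤ (2 * x) ^ (δ - 1) := rpow_le_rpow hu0.le (by linarith [hu.2]) (by linarith)
        _ = 2 ^ (δ - 1) * x ^ (δ - 1) := mul_rpow (by norm_num) hx.le
        _ ≤ 2 ^ (δ + 1) * x ^ (δ - 1) :=
            mul_le_mul_of_nonneg_right (rpow_le_rpow_of_exponent_le h2 (by linarith)) (rpow_nonneg hx.le _)
    · -- `δ < 1`: `u^{δ-1} ≤ (x/2)^{δ-1} = 2^{1-δ} x^{δ-1} ≤ 2^{δ+1} x^{δ-1}`
      calc u ^ (δ - 1) ≤ (x / 2) ^ (δ - 1) := rpow_le_rpow_of_nonpos (by linarith) (by linarith [hu.1]) (by linarith)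
        _ = 2 ^ (1 - δ) * x ^ (δ - 1) := by
            rw [div_eq_mul_inv, mul_rpow hx.le (by norm_num), inv_rpow (by norm_num), ← rpow_neg (by norm_num)]
            ring_nf
        _ ≤ 2 ^ (δ + 1) * x ^ (δ - 1) :=
            mul_le_mul_of_nonneg_right (rpow_le_rpow_of_exponent_le h2 (by linarith)) (rpow_nonneg hx.le _)
  have h := intervalIntegral.norm_integral_le_of_norm_le_const hsup
  rw [hint, Real.norm_eq_abs, abs_of_nonneg (show (0 : ℝ) ≤ b - a by linarith)] at h
  exact (le_abs_self _).trans h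

/-- **Effective Perron inversion of order two — a power saving from a continuation of finite order.**
Let `ℓ : ι → ℝ` be countable with `ℓ_i ≥ 1`, weights `a_i ≥ 0`, `D(s) = Σ a_i ℓ_i^{−s}` absolutely convergent for
`Re s > δ > 0`, and `N(x) = Σ_i a_i 𝟙{ℓ_i ≤ x}` (`countFn`; for `a ≡ 1` the number `#{i : ℓ_i ≤ x}`,
`countFn_one_eq_ncard`). Suppose `D(s) = r/(s − δ) + H(s)` for
`Re s > δ` with `r ≥ 0`, `H` holomorphic on `Re s > σ₀`, `0 ≤ σ₀ < σ₁ < δ`, and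
`‖H(u + it)‖ ≤ M (1 + |t|)^κ` for `σ₁ ≤ u ≤ δ + 1`, all `t`, with `κ < 2`. Then for all `x ≥ 2`,
`|N(x) − r x^δ/δ| ≤ (r (2^{δ+1} + 1/δ) + M · (32/π) 2^{2+σ₁} S(σ₁,κ)) · x^{δ − (δ−σ₁)/3}`,
`S(σ₁,κ) = (8/min(σ₁,1)) ∫ (1+|t|)^{κ−3} dt` — a power saving `x^{−(δ−σ₁)/3}` with a constant LINEAR in `r` and `M`
(Riesz means of order two, shift of the line to `Re s = σ₁`, second-difference unsmoothing with `h = x^{1−θ}/4`).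
[cite: MageeOhWinter2019, §3.4, Lemma 15 – Prop. 17 (method); Ingham Ch. II §5 Thm. B] -/
theorem abs_countFn_sub_main_le {δ : ℝ} (hδ : 0 < δ) (hsum : ∀ σ : ℝ, δ < σ → Summable fun i => a i * ℓ i ^ (-σ))
    {r : ℝ} (hr : 0 ≤ r) {σ₀ σ₁ : ℝ} (hσ₀ : 0 ≤ σ₀) (hσ₀₁ : σ₀ < σ₁) (hσ₁ : σ₁ < δ)
    {H : ℂ → ℂ} (hH : DifferentiableOn ℂ H {s : ℂ | σ₀ < s.re})
    (hD : ∀ s : ℂ, δ < s.re → dirSeries a ℓ s = r / (s - δ) + H s)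
    {κ M : ℝ} (hκ : κ < 2) (hM : 0 ≤ M)
    (hHb : ∀ u : ℝ, σ₁ ≤ u → u ≤ δ + 1 → ∀ t : ℝ, ‖H ((u : ℂ) + t * I)‖ ≤ M * (1 + |t|) ^ κ)
    {x : ℝ} (hx : 2 ≤ x) :
    |countFn a ℓ x - r * x ^ δ / δ| ≤
      (r * (2 ^ (δ + 1) + 1 / δ) + M * (32 / π * 2 ^ (2 + σ₁) * shiftConst σ₁ κ)) * x ^ (δ - (δ - σ₁) / 3) := by
  have hσ₁0 : 0 < σ₁ := lt_of_le_of_lt hσ₀ hσ₀₁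
  have hx0 : 0 < x := by linarith
  have hx1 : 1 ≤ x := by linarith
  set θ : ℝ := (δ - σ₁) / 3 with hθ
  have hθ0 : 0 < θ := by rw [hθ]; linarith
  -- the step `h = x^{1-θ}/4`
  set h : ℝ := x ^ (1 - θ) / 4 with hh
  have hxθ : x ^ (1 - θ) ≤ x := by
    conv_rhs => rw [← rpow_one x]
    exact rpow_le_rpow_of_exponent_le hx1 (by linarith)
  have hxθ0 : 0 < x ^ (1 - θ) := rpow_pos_of_pos hx0 _
  have hh0 : 0 < h := by rw [hh]; positivity
  have h4h : 4 * h = x ^ (1 - θ) := by rw [hh]; ring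
  have h2h : 2 * h ≤ x / 2 := by linarith
  -- summability at `δ + 1` and the sandwiches
  have hs1 : Summable fun i => a i * ℓ i ^ (-(δ + 1)) := hsum _ (by linarith)
  have hδ10 : (0 : ℝ) ≤ δ + 1 := by linarith
  obtain ⟨hN1, -⟩ := riesz2_secondDiff_bounds ha hℓ hδ10 hs1 x hh0
  obtain ⟨-, hN2⟩ := riesz2_secondDiff_bounds ha hℓ hδ10 hs1 (x - 2 * h) hh0
  obtain ⟨-, hM1⟩ := densRiesz2_secondDiff_bounds (r := r) (δ := δ) hr x hh0
  obtain ⟨hM2, -⟩ := densRiesz2_secondDiff_bounds (r := r) (δ := δ) hr (x - 2 * h) hh0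
  rw [sub_add_cancel] at hN2 hM2
  -- the error function at the five points
  obtain ⟨B, hB⟩ : ∃ B : ℝ, B = 1 / (2 * π) * ((2 * x) ^ (2 + σ₁) * M * shiftConst σ₁ κ) := ⟨_, rfl⟩
  have hS0 : 0 ≤ shiftConst σ₁ κ := shiftConst_nonneg hσ₁0
  have hEb : ∀ y : ℝ, 1 ≤ y → y ≤ 2 * x → |riesz2 a ℓ y - densRiesz2 r δ y| ≤ B := by
    intro y hy1 hy2
    refine (abs_riesz2_sub_densRiesz2_le ha hℓ hδ hsum hσ₀ hσ₀₁ hσ₁ hH hD hκ hM hHb hy1).trans ?_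
    rw [hB]
    gcongr
  have hE0 := hEb x hx1 (by linarith)
  have hE1 := hEb (x + h) (by linarith) (by linarith)
  have hE2 := hEb (x + 2 * h) (by linarith) (by linarith)
  have hE3 := hEb (x - h) (by linarith) (by linarith)
  have hE4 := hEb (x - 2 * h) (by linarith) (by linarith)
  rw [abs_le] at hE0 hE1 hE2 hE3 hE4
  -- upper and lower bounds for `N(x)` in terms of `M(x ± 2h)`
  have hsq : 0 < h ^ 2 := by positivity
  have e1 : x - 2 * h + h = x - h := by ring
  rw [e1] at hN2 hM2
  have hup : countFn a ℓ x ≤ densCount r δ (x + 2 * h) + 4 * B / h ^ 2 := by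
    rw [add_div' _ _ _ hsq.ne', le_div_iff₀ hsq]
    linarith [hN1, hM1, hE0.1, hE0.2, hE1.1, hE1.2, hE2.1, hE2.2]
  have hlow : densCount r δ (x - 2 * h) - 4 * B / h ^ 2 ≤ countFn a ℓ x := by
    rw [sub_div' hsq.ne', div_le_iff₀ hsq]
    linarith [hN2, hM2, hE0.1, hE0.2, hE3.1, hE3.2, hE4.1, hE4.2]
  -- `|N(x) − M(x)| ≤ M(x+2h) − M(x−2h) + 4B/h²`
  have hmono := densCount_mono (r := r) (δ := δ) hr
  have hMx1 : densCount r δ x ≤ densCount r δ (x + 2 * h) := hmono (by linarith)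
  have hMx2 : densCount r δ (x - 2 * h) ≤ densCount r δ x := hmono (by linarith)
  have hNM : |countFn a ℓ x - densCount r δ x| ≤
      (densCount r δ (x + 2 * h) - densCount r δ (x - 2 * h)) + 4 * B / h ^ 2 := by
    rw [abs_le]; constructor <;> linarith
  -- (P1) `M(x+2h) − M(x−2h) ≤ r 2^{δ+1} x^{δ−θ}`
  have hP1 : densCount r δ (x + 2 * h) - densCount r δ (x - 2 * h) ≤ r * 2 ^ (δ + 1) * x ^ (δ - θ) := by
    rw [densCount_eq hδ (by linarith), densCount_eq hδ (by linarith)]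
    have hmv := rpow_sub_rpow_div_le (a := x - 2 * h) (b := x + 2 * h) hδ hx0 (by linarith) (by linarith) (by linarith)
    have hba : x + 2 * h - (x - 2 * h) = x ^ (1 - θ) := by linarith
    rw [hba] at hmv
    have hxx : x ^ (δ - 1) * x ^ (1 - θ) = x ^ (δ - θ) := by
      rw [← rpow_add hx0]; ring_nf
    calc r * ((x + 2 * h) ^ δ - 1) / δ - r * ((x - 2 * h) ^ δ - 1) / δ
        = r * (((x + 2 * h) ^ δ - (x - 2 * h) ^ δ) / δ) := by ring
      _ ≤ r * (2 ^ (δ + 1) * x ^ (δ - 1) * x ^ (1 - θ)) := mul_le_mul_of_nonneg_left hmv hr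
      _ = r * 2 ^ (δ + 1) * x ^ (δ - θ) := by rw [← hxx]; ring
  -- (P2) `4B/h² = (32/π) 2^{2+σ₁} M S x^{σ₁+2θ}` and `σ₁ + 2θ = δ − θ`
  have hP2 : 4 * B / h ^ 2 = M * (32 / π * 2 ^ (2 + σ₁) * shiftConst σ₁ κ) * x ^ (δ - θ) := by
    have hh2 : h ^ 2 = x ^ (2 - 2 * θ) / 16 := by
      rw [hh, div_pow, show (x ^ (1 - θ)) ^ 2 = x ^ (2 - 2 * θ) by
        rw [← rpow_natCast, ← rpow_mul hx0.le]; ring_nf]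
      norm_num
    have h2x : (2 * x) ^ (2 + σ₁) = 2 ^ (2 + σ₁) * x ^ (2 + σ₁) := mul_rpow (by norm_num) hx0.le
    have hexp : x ^ (2 + σ₁) / x ^ (2 - 2 * θ) = x ^ (δ - θ) := by
      rw [← rpow_sub hx0]; congr 1; rw [hθ]; ring
    rw [hh2, hB, h2x]
    field_simp
    rw [← hexp]
    field_simp
    ring
  -- (P3) `r/δ ≤ (r/δ) x^{δ−θ}`
  have hxδθ : 1 ≤ x ^ (δ - θ) := one_le_rpow hx1 (by rw [hθ]; linarith)
  have hP3 : r / δ ≤ r / δ * x ^ (δ - θ) := le_mul_of_one_le_right (by positivity) hxδθ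
  -- conclusion
  have hMx : densCount r δ x = r * x ^ δ / δ - r / δ := by rw [densCount_eq hδ hx1]; ring
  calc |countFn a ℓ x - r * x ^ δ / δ|
      = |(countFn a ℓ x - densCount r δ x) + (-(r / δ))| := by rw [hMx]; ring_nf
    _ ≤ |countFn a ℓ x - densCount r δ x| + |-(r / δ)| := abs_add_le _ _
    _ = |countFn a ℓ x - densCount r δ x| + r / δ := by rw [abs_neg, abs_of_nonneg (div_nonneg hr hδ.le)]
    _ ≤ (densCount r δ (x + 2 * h) - densCount r δ (x - 2 * h)) + 4 * B / h ^ 2 + r / δ := by linarith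
    _ ≤ r * 2 ^ (δ + 1) * x ^ (δ - θ) + M * (32 / π * 2 ^ (2 + σ₁) * shiftConst σ₁ κ) * x ^ (δ - θ) +
          r / δ * x ^ (δ - θ) := by linarith
    _ = (r * (2 ^ (δ + 1) + 1 / δ) + M * (32 / π * 2 ^ (2 + σ₁) * shiftConst σ₁ κ)) * x ^ (δ - (δ - σ₁) / 3) := by
          rw [hθ]; ring

omit ha in
/-- The unweighted case (`a ≡ 1`), with `N(x)` the cardinality `#{i : ℓ_i ≤ x}`.
[cite: MageeOhWinter2019, §3.4 (method)] -/
theorem abs_ncard_sub_main_le {δ : ℝ} (hδ : 0 < δ) (hsum : ∀ σ : ℝ, δ < σ → Summable fun i => ℓ i ^ (-σ))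
    {r : ℝ} (hr : 0 ≤ r) {σ₀ σ₁ : ℝ} (hσ₀ : 0 ≤ σ₀) (hσ₀₁ : σ₀ < σ₁) (hσ₁ : σ₁ < δ)
    {H : ℂ → ℂ} (hH : DifferentiableOn ℂ H {s : ℂ | σ₀ < s.re})
    (hD : ∀ s : ℂ, δ < s.re → dirSeries (fun _ => 1) ℓ s = r / (s - δ) + H s)
    {κ M : ℝ} (hκ : κ < 2) (hM : 0 ≤ M)
    (hHb : ∀ u : ℝ, σ₁ ≤ u → u ≤ δ + 1 → ∀ t : ℝ, ‖H ((u : ℂ) + t * I)‖ ≤ M * (1 + |t|) ^ κ)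
    {x : ℝ} (hx : 2 ≤ x) :
    |({i | ℓ i ≤ x}.ncard : ℝ) - r * x ^ δ / δ| ≤
      (r * (2 ^ (δ + 1) + 1 / δ) + M * (32 / π * 2 ^ (2 + σ₁) * shiftConst σ₁ κ)) * x ^ (δ - (δ - σ₁) / 3) := by
  rw [← countFn_one_eq_ncard hℓ (by linarith : (0 : ℝ) ≤ δ + 1) (hsum _ (by linarith))]
  exact abs_countFn_sub_main_le (a := fun _ => 1) (fun _ => zero_le_one) hℓ hδ (fun σ hσ => by simpa using hsum σ hσ)
    hr hσ₀ hσ₀₁ hσ₁ hH hD hκ hM hHb hx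

end Main

end PerronTwo

end Literature.NumberTheory.LFunctions
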